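import Summits.HubbardSuperconductivity.HubbardSuperconductivity.Theses.NodalWardXY

/-!
# VisonPairCost — ideator 3 (round 1) sketch: first lemmas / transfer targets of three crux ideas

Nothing here is proved; every `def … : Prop` elaborates (lean check rc 0).
`M` always denotes the `2L² × 2L²` real-symmetric Nambu (BdG) one-body matrix
`M(s) = [[h(s), Δ(s)], [Δ(s), −h(s)]]` of the crux's quadratic form with Z₂ bond field `s`; the
disprover's `BdGNuclearNormFormula` (Cruxes/VisonPairCost/Disproof.lean §5) gives
`E₀(H_R) − E₀(H_0) = −½ (Σ|λ(M_R)| − Σ|λ(M_0)|)`, so the crux is `|Σ|λ(M_R)| − Σ|λ(M_0)|| ≤ 2C`.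

* Card `toeplitz-string-widom`       : `MatsubaraLogDetFormula`, `StringDeterminantReduction`,
                                       `TwistCostBound`, `WidomRemainderBound`, `ToeplitzChain`.
* Card `rank-pays-infrared-local-weyl`: `RankPaysInfrared`, `LayerCake`, `MomentLocality`,
                                       `LocalWeylNearPair`, `LocalWeylReduction`.
* Card `dyadic-cover-descent`        : `CoverSplittingZ2`, `CoverIdentity`, `PairClustering`,
                                       `DescentStep`.
-/

set_option linter.dupNamespace false

namespace Summit.HubbardSuperconductivity.HubbardSuperconductivity.Cruxes.VisonPairCost.Ideator3

open scoped BigOperators Matrix ComplexConjugate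
open MeasureTheory Literature.Probability.LatticeModels

noncomputable section

/-! ## 0. One-body vocabulary (faithful copies of the disprover's `hMat`/`dMat`, general bond field) -/

variable {n : Type*} [Fintype n] [DecidableEq n]

/-- `Σ_k |λ_k(M)|` (trace norm of a Hermitian matrix). -/
def absEigSum {M : Matrix n n ℂ} (hM : M.IsHermitian) : ℝ := ∑ k, |hM.eigenvalues k|

/-- `log |det(M − iω)|`. -/
def logAbsDet (M : Matrix n n ℂ) (ω : ℝ) : ℝ :=
  Real.log ‖(M - (Complex.I * (ω : ℂ)) • (1 : Matrix n n ℂ)).det‖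

/-- local density of states of `M` at index `x` in the window `a ≤ |λ| ≤ b`. -/
def ldos {M : Matrix n n ℂ} (hM : M.IsHermitian) (a b : ℝ) (x : n) : ℝ :=
  ∑ k, (if a ≤ |hM.eigenvalues k| ∧ |hM.eigenvalues k| ≤ b
        then ‖(hM.eigenvectorBasis k) x‖ ^ 2 else 0)

variable (L : ℕ)

/-- hopping matrix with Z₂ (or twisted) bond field `s`: `−s(x,i)` on the bond `x → x+eᵢ`, `−μ` diagonal. -/
def hMatS [NeZero L] (μ : ℝ) (s : TorusSite 2 L → Fin 2 → ℂ) :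
    Matrix (TorusSite 2 L) (TorusSite 2 L) ℂ :=
  fun x y => (if x = y then (-(μ : ℂ)) else 0)
    + ∑ i : Fin 2, ((if y = x + Pi.single i 1 then -s x i else 0)
                    + (if x = y + Pi.single i 1 then -s y i else 0))

/-- d-wave gap matrix with the same bond field: `s(x,i) Δ₀ gᵢ`, `g = (+1, −1)`. -/
def dMatS [NeZero L] (Δ₀ : ℝ) (s : TorusSite 2 L → Fin 2 → ℂ) :
    Matrix (TorusSite 2 L) (TorusSite 2 L) ℂ :=
  fun x y => ∑ i : Fin 2, ((Δ₀ * (if i = 0 then (1 : ℝ) else -1) : ℝ) : ℂ) *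
    ((if y = x + Pi.single i 1 then s x i else 0) + (if x = y + Pi.single i 1 then s y i else 0))

/-- the Nambu (BdG) one-body matrix `[[h, Δ],[Δ, −h]]`. -/
def nambuM [NeZero L] (μ Δ₀ : ℝ) (s : TorusSite 2 L → Fin 2 → ℂ) :
    Matrix (TorusSite 2 L ⊕ TorusSite 2 L) (TorusSite 2 L ⊕ TorusSite 2 L) ℂ :=
  Matrix.fromBlocks (hMatS L μ s) (dMatS L Δ₀ s) (dMatS L Δ₀ s) (-(hMatS L μ s))

/-- the crux's string `s_R`: `−1` on the vertical bonds leaving `(a,0)`, `a < R`.  `R = L` is the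
full row = the y-antiperiodic TWIST with no vison (Disproof §3). -/
def sPair (R : ℕ) : TorusSite 2 L → Fin 2 → ℂ :=
  fun x i => if i = 1 ∧ x 1 = 0 ∧ (x 0).val < R then -1 else 1

/-- the same string with boundary twists `η₀, η₁ ∈ {±1}` on the bonds crossing `x₀ = L−1 | 0`,
`x₁ = L−1 | 0` (deck characters of the 4-fold cover). -/
def sPairTwist (R : ℕ) (η₀ η₁ : ℂ) : TorusSite 2 L → Fin 2 → ℂ :=
  fun x i => sPair L R x i * (if i = 0 ∧ (x 0).val = L - 1 then η₀ else 1)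
    * (if i = 1 ∧ (x 1).val = L - 1 then η₁ else 1)

/-- the LIFT of `s_R` to the `2L`-torus (4-fold cover): strings in rows `0` and `L`, columns
`a mod L < R` — four translated vison pairs (8 visons). -/
def sLift (R : ℕ) : TorusSite 2 (2 * L) → Fin 2 → ℂ :=
  fun x i => if i = 1 ∧ ((x 1).val = 0 ∨ (x 1).val = L) ∧ (x 0).val % L < R then -1 else 1

/-! ## 1. Card `toeplitz-string-widom` -/

/-- FIRST LEMMA (Matsubara log-determinant formula).  For Hermitian `A, B` of the same size,
`Σ|λ(A)| − Σ|λ(B)| = (1/π) ∫_ℝ (log|det(A − iω)| − log|det(B − iω)|) dω`; the integrand is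
`O(ω⁻²)` at infinity (the `ω⁻¹` terms are imaginary) and log-integrable at `0`, for ANY pair. -/
def MatsubaraLogDetFormula : Prop :=
  ∀ (m : ℕ) (A B : Matrix (Fin m) (Fin m) ℂ) (hA : A.IsHermitian) (hB : B.IsHermitian),
    Integrable (fun ω : ℝ => logAbsDet A ω - logAbsDet B ω) ∧
    absEigSum hA - absEigSum hB = (1 / Real.pi) * ∫ ω : ℝ, (logAbsDet A ω - logAbsDet B ω)

/-- Sylvester reduction to the string: if `V = P V P` for an idempotent `P` then
`det(B + V − z) = det(B − z) · det(1 + P V P (B − z)⁻¹ P)` — only the `S × S` block (`S = ran P`,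
the `4R` string indices) of the FREE resolvent enters; along the straight string that block is
block-Toeplitz (a finite section of an `L`-block-circulant with `4 × 4` symbol `φ_ω(k)`). -/
def StringDeterminantReduction : Prop :=
  ∀ (m : ℕ) (B V P : Matrix (Fin m) (Fin m) ℂ) (z : ℂ),
    P * P = P → V = P * V * P → IsUnit (B - z • (1 : Matrix (Fin m) (Fin m) ℂ)).det →
      (B + V - z • (1 : Matrix (Fin m) (Fin m) ℂ)).det
        = (B - z • (1 : Matrix (Fin m) (Fin m) ℂ)).det
          * (1 + P * V * P * (B - z • (1 : Matrix (Fin m) (Fin m) ℂ))⁻¹ * P).det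

/-- The Szegő MEAN of the string symbol is the twist: `Π_k det φ_ω(k) = det(M_L − iω)/det(M_0 − iω)`
(`M_L` = full-row string = y-antiperiodic twist, no vison).  What the line needs from it is only the
bounded twist cost (numerically `O(1/L)`, Disproof j007910 `dE_yAP`). -/
def TwistCostBound : Prop :=
  ∀ μ : ℝ, μ ∈ Set.Ioo (-4 : ℝ) 4 → μ ≠ 0 → ∀ Δ₀ : ℝ, 0 < Δ₀ → ∃ C : ℝ,
    ∀ (L : ℕ) [NeZero L], 4 ≤ L →
      ∀ (hT : (nambuM L μ Δ₀ (sPair L L)).IsHermitian) (h0 : (nambuM L μ Δ₀ (sPair L 0)).IsHermitian),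
        |absEigSum hT - absEigSum h0| ≤ C

/-- TRANSFER TARGET of the card (uniform Widom / emerging-Fisher–Hartwig remainder):
after subtracting the tension term `(R/L)·(twist log-det ratio)`, the string log-determinant is
ω-integrable UNIFORMLY in `L, R` — expected pointwise size `≲ 1 + log min(R, 1/|ω|)` near `ω = 0`
and `≲ ω⁻⁴` at infinity. -/
def WidomRemainderBound : Prop :=
  ∀ μ : ℝ, μ ∈ Set.Ioo (-4 : ℝ) 4 → μ ≠ 0 → ∀ Δ₀ : ℝ, 0 < Δ₀ → ∃ C : ℝ,
    ∀ (L : ℕ) [NeZero L], 4 ≤ L → ∀ R : ℕ, 2 * R ≤ L →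
      Integrable (fun ω : ℝ =>
        logAbsDet (nambuM L μ Δ₀ (sPair L R)) ω - logAbsDet (nambuM L μ Δ₀ (sPair L 0)) ω
          - (R / L : ℝ) * (logAbsDet (nambuM L μ Δ₀ (sPair L L)) ω
                            - logAbsDet (nambuM L μ Δ₀ (sPair L 0)) ω)) ∧
      ∫ ω : ℝ, |logAbsDet (nambuM L μ Δ₀ (sPair L R)) ω - logAbsDet (nambuM L μ Δ₀ (sPair L 0)) ω
          - (R / L : ℝ) * (logAbsDet (nambuM L μ Δ₀ (sPair L L)) ω
                            - logAbsDet (nambuM L μ Δ₀ (sPair L 0)) ω)| ≤ C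

/-- The card's chain (with the disprover's `BdGNuclearNormFormula` as the entry point). -/
def ToeplitzChain : Prop :=
  MatsubaraLogDetFormula → TwistCostBound → WidomRemainderBound →
    Summit.HubbardSuperconductivity.HubbardSuperconductivity.Theses.NodalWardXY.VisonPairCost

/-! ## 2. Card `rank-pays-infrared-local-weyl` -/

/-- FIRST LEMMA ("rank pays the infrared"): truncating `|λ|` below a level `E` costs at most
`2 r E` against a rank-`r` perturbation (interlacing).  With `r = 4R ≤ 2L` and `E = 1/L` the whole
window `|λ| ≤ 1/L` of the vison-pair cost is paid with `≤ 4`. -/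
def RankPaysInfrared : Prop :=
  ∀ (m : ℕ) (A B : Matrix (Fin m) (Fin m) ℂ) (hA : A.IsHermitian) (hB : B.IsHermitian)
    (r : ℕ) (E : ℝ), (A - B).rank ≤ r → 0 ≤ E →
      |(∑ k, min |hA.eigenvalues k| E) - ∑ k, min |hB.eigenvalues k| E| ≤ 2 * r * E

/-- layer cake: `Σ|λ(A)| − Σ|λ(B)| = −∫_0^Λ (N_A(E) − N_B(E)) dE`, `N(E) = #{k : |λ_k| ≤ E}`. -/
def LayerCake : Prop :=
  ∀ (m : ℕ) (A B : Matrix (Fin m) (Fin m) ℂ) (hA : A.IsHermitian) (hB : B.IsHermitian) (Λ : ℝ),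
    (∀ k, |hA.eigenvalues k| ≤ Λ) → (∀ k, |hB.eigenvalues k| ≤ Λ) →
      absEigSum hA - absEigSum hB
        = -∫ E in Set.Icc (0 : ℝ) Λ,
            (((Finset.univ.filter fun k => |hA.eigenvalues k| ≤ E).card : ℝ)
              - ((Finset.univ.filter fun k => |hB.eigenvalues k| ≤ E).card : ℝ))

/-- UV IS EXACTLY R-INDEPENDENT (path expansion): a closed lattice path of length `n < L` does not
wrap the torus, and one of length `n < 2R + 4` cannot wind around both visons; hence
`Tr M_R^n` is the same for all `R ≥ 1` in that range (it differs from `Tr M_0^n` by `−4 m_n(μ,Δ₀)`,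
the single-plaquette odd-winding loop sum). -/
def MomentLocality : Prop :=
  ∀ (μ Δ₀ : ℝ) (L : ℕ) [NeZero L] (R R' k : ℕ), 1 ≤ R → 1 ≤ R' → 2 * R ≤ L → 2 * R' ≤ L →
    k < L → k < 2 * R + 4 → k < 2 * R' + 4 →
      ((nambuM L μ Δ₀ (sPair L R)) ^ k).trace = ((nambuM L μ Δ₀ (sPair L R')) ^ k).trace

/-- TRANSFER TARGET `C⁺` (averaged local Weyl bound near the pair, with a full power of slack):
the spectral mass of `M_R` in the window `ε ≤ |λ| ≤ 2ε` carried within distance `ε^{-(1+δ)}` of the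
two visons is `≤ C ε^{-(1−δ')}` for all `ε ∈ [1/L, Λ]` — truth is `≈ ε^{-2δ}` (Dirac `ε²` per site
plus `ε/d` zero-mode tails), the trivial bound is `ε^{-2−2δ}`. -/
def LocalWeylNearPair : Prop :=
  ∀ μ : ℝ, μ ∈ Set.Ioo (-4 : ℝ) 4 → μ ≠ 0 → ∀ Δ₀ : ℝ, 0 < Δ₀ →
    ∃ δ δ' C : ℝ, 0 < δ ∧ 0 < δ' ∧ ∀ (L : ℕ) [NeZero L], 4 ≤ L → ∀ R : ℕ, 2 * R ≤ L →
      ∀ (hM : (nambuM L μ Δ₀ (sPair L R)).IsHermitian) (ε : ℝ),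
        (1 : ℝ) / L ≤ ε → ε ≤ 8 + |μ| + 8 * Δ₀ →
          (∑ x : TorusSite 2 L,
              if (min ((torusGraph 2 L).dist x (fun j => if j = 0 then ((R : ℕ) : ZMod L) else 0))
                      ((torusGraph 2 L).dist x 0) : ℝ) ≤ ε ^ (-(1 + δ)) then
                (ldos hM ε (2 * ε) (Sum.inl x) + ldos hM ε (2 * ε) (Sum.inr x)) else 0)
            ≤ C * ε ^ (-(1 - δ'))

/-- The card's claim: the crux follows from `C⁺` by bookkeeping alone
(`RankPaysInfrared` below `1/L`, dyadic Helffer–Sjöstrand locality above). -/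
def LocalWeylReduction : Prop :=
  LocalWeylNearPair →
    Summit.HubbardSuperconductivity.HubbardSuperconductivity.Theses.NodalWardXY.VisonPairCost

/-! ## 3. Card `dyadic-cover-descent` -/

/-- FIRST LEMMA (ℤ₂ cover splitting, minimal matrix form): `Σ|λ([[A,B],[B,A]])| = Σ|λ(A+B)| + Σ|λ(A−B)|`. -/
def CoverSplittingZ2 : Prop :=
  ∀ (m : ℕ) (A B : Matrix (Fin m) (Fin m) ℂ)
    (hM : (Matrix.fromBlocks A B B A).IsHermitian) (hp : (A + B).IsHermitian)
    (hm : (A - B).IsHermitian),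
      absEigSum hM = absEigSum hp + absEigSum hm

/-- The exact 4-fold COVER IDENTITY of the card: summing the twisted pair trace norms over the four
deck characters `η ∈ {±1}²` of the `L`-torus gives the trace norm of the LIFTED configuration (four
translated pairs) on the `2L`-torus.  Valid for every `R ≤ L` (so all separations of the big torus
are reached through `R ↔ L − R` + twist). -/
def CoverIdentity : Prop :=
  ∀ (μ Δ₀ : ℝ) (L : ℕ) [NeZero L] [NeZero (2 * L)] (R : ℕ), 4 ≤ L → R ≤ L →
    ∀ (hpp : (nambuM L μ Δ₀ (sPairTwist L R 1 1)).IsHermitian)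
      (hpm : (nambuM L μ Δ₀ (sPairTwist L R 1 (-1))).IsHermitian)
      (hmp : (nambuM L μ Δ₀ (sPairTwist L R (-1) 1)).IsHermitian)
      (hmm : (nambuM L μ Δ₀ (sPairTwist L R (-1) (-1))).IsHermitian)
      (hlift : (nambuM (2 * L) μ Δ₀ (sLift L R)).IsHermitian),
      absEigSum hpp + absEigSum hpm + absEigSum hmp + absEigSum hmm = absEigSum hlift

/-- TRANSFER TARGET (clustering of distant NEUTRAL pairs, any summable rate): on the `2L`-torus the
cost of the four lifted pairs is four times the cost of one pair up to `C (2L)^{-κ}`, uniformly in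
`R ≤ L/2` (periodic sector shown; the line needs it for all Bloch twists, see card). -/
def PairClustering : Prop :=
  ∀ μ : ℝ, μ ∈ Set.Ioo (-4 : ℝ) 4 → μ ≠ 0 → ∀ Δ₀ : ℝ, 0 < Δ₀ → ∃ κ C : ℝ, 0 < κ ∧
    ∀ (L : ℕ) [NeZero L] [NeZero (2 * L)], 4 ≤ L → ∀ R : ℕ, 2 * R ≤ L →
      ∀ (hlift : (nambuM (2 * L) μ Δ₀ (sLift L R)).IsHermitian)
        (hone : (nambuM (2 * L) μ Δ₀ (sPair (2 * L) R)).IsHermitian)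
        (hzero : (nambuM (2 * L) μ Δ₀ (sPair (2 * L) 0)).IsHermitian),
        |(absEigSum hlift - absEigSum hzero) - 4 * (absEigSum hone - absEigSum hzero)|
          ≤ C * ((2 * L : ℕ) : ℝ) ^ (-κ)

/-- The descent step the card extracts from `CoverIdentity ∧ PairClustering`:
`a(2L) ≤ a(L) + C (2L)^{-κ}` for `a(L) := sup_{R ≤ L/2, twists} |ΔE|`; summable over dyadic `L`,
base case = certified finite computation. (Stated for the periodic-sector supremum.) -/
def DescentStep : Prop :=
  ∀ μ : ℝ, μ ∈ Set.Ioo (-4 : ℝ) 4 → μ ≠ 0 → ∀ Δ₀ : ℝ, 0 < Δ₀ → ∃ κ C : ℝ, 0 < κ ∧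
    ∀ (L : ℕ) [NeZero L] [NeZero (2 * L)], 4 ≤ L → ∀ a : ℝ,
      (∀ R : ℕ, R ≤ L → ∀ (η₀ η₁ : ℂ), (η₀ = 1 ∨ η₀ = -1) → (η₁ = 1 ∨ η₁ = -1) →
        ∀ (hR : (nambuM L μ Δ₀ (sPairTwist L R η₀ η₁)).IsHermitian)
          (h0 : (nambuM L μ Δ₀ (sPairTwist L 0 η₀ η₁)).IsHermitian),
          |absEigSum hR - absEigSum h0| ≤ a) →
      ∀ R : ℕ, R ≤ L →
        ∀ (hR : (nambuM (2 * L) μ Δ₀ (sPair (2 * L) R)).IsHermitian)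
          (h0 : (nambuM (2 * L) μ Δ₀ (sPair (2 * L) 0)).IsHermitian),
          |absEigSum hR - absEigSum h0| ≤ a + C * ((2 * L : ℕ) : ℝ) ^ (-κ)

end

end Summit.HubbardSuperconductivity.HubbardSuperconductivity.Cruxes.VisonPairCost.Ideator3
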